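/-
Copyright (c) 2026. All rights reserved.
Released under Apache 2.0 license as described in the file LICENSE.
-/
import Literature.MathematicalPhysics.QuantumLattice.HartreeFockFreeFermionTorus
import Literature.MathematicalPhysics.QuantumLattice.HartreeFockSDWThermodynamicLimit
import Literature.MathematicalPhysics.QuantumLattice.FreeFermionSectorEnergyDeviation
import HarnessLib

/-!
# The free-fermion (paramagnetic Hartree–Fock) upper bound on the 2D Hubbard energy density at arbitrary filling

Topic `MathematicalPhysics/QuantumLattice`, family `hubbard`; continuation of
`HartreeFockFreeFermionTorus.lean` (`hubbardTorus_groundEnergyAt_le_freeFermion`: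
`E_L(|S↑|+|S↓|) ≤ Σ_{S↑} ε + Σ_{S↓} ε + U|S↑||S↓|/L^d` on every torus `(ℤ/Lℤ)^d`, `L ≥ 3`).
Passing to the thermodynamic limit needs the momentum sums of a FERMI SEA, i.e. Riemann sums of a
discontinuous indicator; we avoid them by the **bathtub principle**: the sum of the `m` lowest
levels is at most `Σ_k f_k ε_k + max|ε| · |m - Σ_k f_k|` for ANY fractional occupation
`0 ≤ f ≤ 1` (`sum_lowest_le_of_occupation`, from the tree's `exists_fermiSet`), and fractional
occupations may be taken continuous in the momentum. Results:

* `groundEnergyAt_le_of_occupation` — on the torus `(ℤ/Lℤ)^d`, `L ≥ 3`, for every `g` with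
  `0 ≤ g ≤ 1` and every `m ≤ L^d`:
  `E_L(2m) ≤ 2 Σ_z g(c_z) ε̃(c_z) + 4d|t| · |m - Σ_z g(c_z)| + U m²/L^d`, where `c_z` runs over the
  corners of the momentum grid (`cellCorner`) and `ε̃(p) = 2tΣᵢcos pᵢ = sdwBand t p` is the
  plane-wave energy read at the corner (`ε_{-t}(c + (π,…,π)) = sdwBand t c`);
* **`energyDensity2D_le_freeFermion`** — for `U ≥ 0`, `0 ≤ n < 2` and every continuous
  `g : (Fin 2 → ℝ) → [0,1]` with `(2π)⁻² ∫_{[-π,π]²} g = n/2`: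

    `e(t,U,n) ≤ 2 (2π)⁻² ∫_{[-π,π]²} g(p) · 2t(cos p₁ + cos p₂) dp + U (n/2)²`.

  Letting `g` approximate the indicator of `{2t(cos p₁ + cos p₂) < μ}` (the occupation of the plane
  wave of momentum `p + (π,π)`, whose kinetic energy is `2t(cos p₁ + cos p₂)`) recovers the
  textbook paramagnetic Hartree–Fock value `e_free(n) + U n²/4`; any explicit continuous `g` gives a
  certified upper bound after one quadrature.
* `groundEnergyAt_le_of_occupation₂`, **`energyDensity2D_le_freeFermion₂`** — the same with
  INDEPENDENT occupation profiles `g↑, g↓` for the two spins (collinear Slater states):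
  `e(t,U,n↑+n↓) ≤ (2π)⁻² ∫ g↑ ε + (2π)⁻² ∫ g↓ ε + U n↑ n↓`; and its corner case
  `energyDensity2D_le_polarizedFreeFermion` (the fully spin-polarised Fermi sea, `n ≤ 1`:
  `e(t,U,n) ≤ (2π)⁻² ∫ g ε`, no interaction energy).

Everything is proved; no definitions, no named facts.

## Mathlib / tree search

Tree (REUSED): `exists_fermiSet` (`FreeFermionSectorEnergyDeviation`),
`HartreeFock.hubbardTorus_groundEnergyAt_le_freeFermion`, `HartreeFock.sdwBand`, `sdwBand_add_pi`,
`continuous_sdwBand`, `LangerMattis.siteBand`, `latticeMomentum_eq_cellCorner_add`,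
`cornerRiemannSum_eq`, `gridStep`, `tendsto_cornerRiemannSum`, `ThermodynamicLimit.rectN`,
`rectN_le_two_mul`, `tendsto_rectN_div_sq`, `tendsto_energyDensity2D_torus`,
`FermionTorus.sum_eq_sum_torusSite`, `card_fermionTorus_eq`.
`lean search 'freeFermion|bathtub|energyDensity2D_le'`: no thermodynamic-limit free-fermion upper
bound in the tree.

## References

* E. H. Lieb, M. Loss, *Analysis* (2001), Thm 1.14 (bathtub principle). [folklore]
* V. Bach, E. H. Lieb, J. P. Solovej, J. Stat. Phys. 76 (1994) 3, eq. (2c.36). [BachLiebSolovej1994]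
-/

noncomputable section

namespace Literature.MathematicalPhysics.QuantumLattice

namespace HartreeFock

open Matrix Finset Filter Topology Literature.Probability.LatticeModels
  Literature.MathematicalPhysics.QuantumLattice.LangerMattis ThermodynamicLimit
open scoped Topology

/-! ### The bathtub bound with slack -/

section Bathtub

variable {ι : Type*} [Fintype ι] [DecidableEq ι]

/-- **Bathtub bound with slack.** If `|ε| ≤ M`, `0 ≤ f ≤ 1` and `m ≤ |ι|`, some `m`-subset `S` has
`Σ_{S} ε ≤ Σ_i f_i ε_i + M |m - Σ_i f_i|` (take `m` lowest levels `S` and their Fermi level `μ`: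
`Σ_i f_i ε_i - Σ_S ε = Σ_S (f_i - 1)ε_i + Σ_{Sᶜ} f_i ε_i ≥ μ (Σ_i f_i - m)`). [folklore] -/
theorem sum_lowest_le_of_occupation (ε f : ι → ℝ) {M : ℝ} (hε : ∀ i, |ε i| ≤ M)
    (hf0 : ∀ i, 0 ≤ f i) (hf1 : ∀ i, f i ≤ 1) {m : ℕ} (hm : m ≤ Fintype.card ι) :
    ∃ S : Finset ι, S.card = m ∧
      ∑ i ∈ S, ε i ≤ ∑ i, f i * ε i + M * |(m : ℝ) - ∑ i, f i| := by
  obtain ⟨S, eF, hS, hle, hge⟩ := exists_fermiSet ε hm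
  refine ⟨S, hS, ?_⟩
  rcases S.eq_empty_or_nonempty with h0 | hne
  · -- `m = 0`: the right-hand side is `Σ_i f_i (ε_i + M) ≥ 0`
    subst h0
    have hm0 : (m : ℝ) = 0 := by rw [← hS]; simp
    rw [Finset.sum_empty, hm0, zero_sub, abs_neg,
      abs_of_nonneg (Finset.sum_nonneg fun i _ => hf0 i), Finset.mul_sum, ← Finset.sum_add_distrib]
    refine Finset.sum_nonneg fun i _ => ?_
    have h1 : -M ≤ ε i := neg_le_of_abs_le (hε i)
    nlinarith [hf0 i]
  · -- Fermi level `μ = max_S ε = ε k₀`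
    obtain ⟨k₀, hk₀, hk₀eq⟩ := Finset.exists_mem_eq_sup' hne ε
    set μ := S.sup' hne ε with hμ
    have hμS : ∀ i ∈ S, ε i ≤ μ := fun i hi => Finset.le_sup' ε hi
    have hμC : ∀ i ∈ Sᶜ, μ ≤ ε i := fun i hi => by
      rw [hk₀eq]
      exact (hle k₀ hk₀).trans (hge i (Finset.mem_compl.1 hi))
    have hμM : |μ| ≤ M := by rw [hk₀eq]; exact hε k₀
    have h1 : ∑ i ∈ S, (f i - 1) * μ ≤ ∑ i ∈ S, (f i - 1) * ε i :=
      Finset.sum_le_sum fun i hi => mul_le_mul_of_nonpos_left (hμS i hi) (by linarith [hf1 i])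
    have h2 : ∑ i ∈ Sᶜ, f i * μ ≤ ∑ i ∈ Sᶜ, f i * ε i :=
      Finset.sum_le_sum fun i hi => mul_le_mul_of_nonneg_left (hμC i hi) (hf0 i)
    have hA : ∑ i ∈ S, (f i - 1) * μ = (∑ i ∈ S, f i - m) * μ := by
      rw [← Finset.sum_mul, Finset.sum_sub_distrib, Finset.sum_const, nsmul_eq_mul, mul_one, hS]
    have hB : ∑ i ∈ Sᶜ, f i * μ = (∑ i ∈ Sᶜ, f i) * μ := by rw [Finset.sum_mul]
    have hC : ∑ i ∈ S, (f i - 1) * ε i = ∑ i ∈ S, f i * ε i - ∑ i ∈ S, ε i := by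
      rw [← Finset.sum_sub_distrib]
      exact Finset.sum_congr rfl fun i _ => by ring
    have hsplit : ∑ i, f i * ε i = ∑ i ∈ S, f i * ε i + ∑ i ∈ Sᶜ, f i * ε i :=
      (Finset.sum_add_sum_compl S _).symm
    have hsplitf : ∑ i, f i = ∑ i ∈ S, f i + ∑ i ∈ Sᶜ, f i :=
      (Finset.sum_add_sum_compl S _).symm
    have hsum := add_le_add h1 h2
    rw [hA, hB, hC] at hsum
    have key : ∑ i ∈ S, ε i ≤ ∑ i, f i * ε i + μ * ((m : ℝ) - ∑ i, f i) := by
      rw [hsplit, hsplitf]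
      nlinarith [hsum]
    have hlast : μ * ((m : ℝ) - ∑ i, f i) ≤ M * |(m : ℝ) - ∑ i, f i| :=
      calc μ * ((m : ℝ) - ∑ i, f i) ≤ |μ * ((m : ℝ) - ∑ i, f i)| := le_abs_self _
        _ = |μ| * |(m : ℝ) - ∑ i, f i| := abs_mul _ _
        _ ≤ M * |(m : ℝ) - ∑ i, f i| := mul_le_mul_of_nonneg_right hμM (abs_nonneg _)
    linarith

end Bathtub

/-! ### Finite volume: plane waves with a fractional occupation profile -/

section Finite

variable {d L : ℕ} [NeZero L]

omit [NeZero L] in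
/-- `|ε_k| ≤ 2d|t|` for the torus band `ε_k = 2tΣᵢcos(2πkᵢ/L)`. [folklore] -/
theorem abs_siteBand_le (t : ℝ) (k : FermionTorus d L) : |siteBand t k| ≤ 2 * d * |t| := by
  rw [siteBand, abs_mul]
  have h : |2 * ∑ i, Real.cos (latticeMomentum L k.toTorusSite i)| ≤ 2 * d := by
    rw [abs_mul, abs_two]
    refine mul_le_mul_of_nonneg_left ?_ zero_le_two
    calc |∑ i, Real.cos (latticeMomentum L k.toTorusSite i)|
        ≤ ∑ i, |Real.cos (latticeMomentum L k.toTorusSite i)| := Finset.abs_sum_le_sum_abs _ _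
      _ ≤ ∑ _i : Fin d, (1 : ℝ) := Finset.sum_le_sum fun i _ => Real.abs_cos_le_one _
      _ = d := by simp
  calc |t| * |2 * ∑ i, Real.cos (latticeMomentum L k.toTorusSite i)| ≤ |t| * (2 * d) :=
        mul_le_mul_of_nonneg_left h (abs_nonneg t)
    _ = 2 * d * |t| := by ring

/-- The plane-wave energy at the momentum of the torus site `z`, read at the grid CORNER
`c_z = 2πz/L - (π,…,π)`: `ε_{-t}(2πz/L) = 2tΣᵢcos(c_z)ᵢ = sdwBand t c_z`. [folklore] -/
theorem siteBand_neg_ofTorusSite_eq_sdwBand (t : ℝ) (z : TorusSite d L) :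
    siteBand (-t) (FermionTorus.ofTorusSite z) = sdwBand t (cellCorner z) := by
  rw [siteBand_neg_ofTorusSite, latticeMomentum_eq_cellCorner_add]
  simp only [sdwBand, Pi.add_apply, Real.cos_add_pi, Finset.sum_neg_distrib, mul_neg, neg_neg]

/-- Normalisation of corner sums: `L^{-d} Σ_z F(c_z) = (2π)^{-d} · cornerRiemannSum F L`.
[folklore] -/
theorem sum_cellCorner_div_eq (F : (Fin d → ℝ) → ℝ) :
    (∑ z : TorusSite d L, F (cellCorner z)) / (L : ℝ) ^ d =
      ((2 * Real.pi) ^ d)⁻¹ * cornerRiemannSum F L := by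
  have hL : (0 : ℝ) < L := by exact_mod_cast Nat.pos_of_ne_zero (NeZero.ne L)
  have hπ : (0 : ℝ) < 2 * Real.pi := by positivity
  rw [cornerRiemannSum_eq]
  simp_rw [smul_eq_mul]
  rw [← Finset.mul_sum, gridStep, div_pow, div_eq_iff (pow_ne_zero _ hL.ne'), mul_assoc,
    mul_comm _ ((L : ℝ) ^ d), ← mul_assoc, ← mul_assoc]
  field_simp

/-- **Free-fermion bound with a fractional occupation profile.** On the torus `(ℤ/Lℤ)^d`,
`L ≥ 3`, for all real `t, U`, every `g` with `0 ≤ g ≤ 1` and every `m ≤ L^d`: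
`E_L(2m) ≤ 2Σ_z g(c_z)·sdwBand t (c_z) + 2·(2d|t|)·|m - Σ_z g(c_z)| + U m²/L^d`
(fill `m` lowest plane waves per spin; bathtub bound with slack). [cite: BachLiebSolovej1994, eq. (2c.36)] -/
theorem groundEnergyAt_le_of_occupation (hL : 3 ≤ L) (t U : ℝ) {g : (Fin d → ℝ) → ℝ}
    (hg0 : ∀ p, 0 ≤ g p) (hg1 : ∀ p, g p ≤ 1) {m : ℕ} (hm : m ≤ L ^ d) :
    groundEnergyAt (fermionTorusGraph d L) t U (m + m) ≤
      2 * (∑ z : TorusSite d L, g (cellCorner z) * sdwBand t (cellCorner z)) +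
        2 * (2 * d * |t|) * |(m : ℝ) - ∑ z : TorusSite d L, g (cellCorner z)| +
        U * ((m : ℝ) * m) / (L : ℝ) ^ d := by
  classical
  have hM : ∀ k : FermionTorus d L, |siteBand (-t) k| ≤ 2 * d * |t| := fun k => by
    simpa only [abs_neg] using abs_siteBand_le (-t) k
  have hm' : m ≤ Fintype.card (FermionTorus d L) := by rwa [card_fermionTorus_eq]
  obtain ⟨S, hS, hsum⟩ := sum_lowest_le_of_occupation (ι := FermionTorus d L)
    (fun k => siteBand (-t) k) (fun k => g (cellCorner k.toTorusSite)) hM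
    (fun k => hg0 _) (fun k => hg1 _) hm'
  have h := hubbardTorus_groundEnergyAt_le_freeFermion (d := d) hL t U S S
  rw [hS] at h
  have h1 : ∑ k : FermionTorus d L, g (cellCorner k.toTorusSite) * siteBand (-t) k =
      ∑ z : TorusSite d L, g (cellCorner z) * sdwBand t (cellCorner z) := by
    rw [FermionTorus.sum_eq_sum_torusSite]
    refine Finset.sum_congr rfl fun z _ => ?_
    rw [FermionTorus.toTorusSite_ofTorusSite, siteBand_neg_ofTorusSite_eq_sdwBand]
  have h2 : ∑ k : FermionTorus d L, g (cellCorner k.toTorusSite) =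
      ∑ z : TorusSite d L, g (cellCorner z) := by
    rw [FermionTorus.sum_eq_sum_torusSite]
    simp only [FermionTorus.toTorusSite_ofTorusSite]
  rw [h1, h2] at hsum
  linarith

/-- **Free-fermion bound with one fractional occupation profile PER SPIN (collinear Slater states,
incl. the polarised Fermi sea).** On the torus `(ℤ/Lℤ)^d`, `L ≥ 3`, for all real `t, U`, all
`g↑, g↓` with `0 ≤ g_σ ≤ 1` and all `m↑, m↓ ≤ L^d`:
`E_L(m↑ + m↓) ≤ Σ_σ [Σ_z g_σ(c_z)·sdwBand t (c_z) + 2d|t|·|m_σ - Σ_z g_σ(c_z)|] + U m↑m↓/L^d`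
(fill the `m_σ` lowest plane waves in spin `σ`; bathtub bound with slack in each spin; the on-site
densities of the Slater state are `m↑/L^d` and `m↓/L^d`). [cite: BachLiebSolovej1994, eq. (2c.36)] -/
theorem groundEnergyAt_le_of_occupation₂ (hL : 3 ≤ L) (t U : ℝ) {gu gd : (Fin d → ℝ) → ℝ}
    (hgu0 : ∀ p, 0 ≤ gu p) (hgu1 : ∀ p, gu p ≤ 1) (hgd0 : ∀ p, 0 ≤ gd p) (hgd1 : ∀ p, gd p ≤ 1)
    {mu md : ℕ} (hmu : mu ≤ L ^ d) (hmd : md ≤ L ^ d) :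
    groundEnergyAt (fermionTorusGraph d L) t U (mu + md) ≤
      (∑ z : TorusSite d L, gu (cellCorner z) * sdwBand t (cellCorner z)) +
        2 * d * |t| * |(mu : ℝ) - ∑ z : TorusSite d L, gu (cellCorner z)| +
      ((∑ z : TorusSite d L, gd (cellCorner z) * sdwBand t (cellCorner z)) +
        2 * d * |t| * |(md : ℝ) - ∑ z : TorusSite d L, gd (cellCorner z)|) +
        U * ((mu : ℝ) * md) / (L : ℝ) ^ d := by
  classical
  have hM : ∀ k : FermionTorus d L, |siteBand (-t) k| ≤ 2 * d * |t| := fun k => by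
    simpa only [abs_neg] using abs_siteBand_le (-t) k
  have hmu' : mu ≤ Fintype.card (FermionTorus d L) := by rwa [card_fermionTorus_eq]
  have hmd' : md ≤ Fintype.card (FermionTorus d L) := by rwa [card_fermionTorus_eq]
  obtain ⟨Su, hSu, hsumu⟩ := sum_lowest_le_of_occupation (ι := FermionTorus d L)
    (fun k => siteBand (-t) k) (fun k => gu (cellCorner k.toTorusSite)) hM
    (fun k => hgu0 _) (fun k => hgu1 _) hmu'
  obtain ⟨Sd, hSd, hsumd⟩ := sum_lowest_le_of_occupation (ι := FermionTorus d L)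
    (fun k => siteBand (-t) k) (fun k => gd (cellCorner k.toTorusSite)) hM
    (fun k => hgd0 _) (fun k => hgd1 _) hmd'
  have h := hubbardTorus_groundEnergyAt_le_freeFermion (d := d) hL t U Su Sd
  rw [hSu, hSd] at h
  have h1 : ∀ g : (Fin d → ℝ) → ℝ,
      ∑ k : FermionTorus d L, g (cellCorner k.toTorusSite) * siteBand (-t) k =
        ∑ z : TorusSite d L, g (cellCorner z) * sdwBand t (cellCorner z) := fun g => by
    rw [FermionTorus.sum_eq_sum_torusSite]
    refine Finset.sum_congr rfl fun z _ => ?_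
    rw [FermionTorus.toTorusSite_ofTorusSite, siteBand_neg_ofTorusSite_eq_sdwBand]
  have h2 : ∀ g : (Fin d → ℝ) → ℝ, ∑ k : FermionTorus d L, g (cellCorner k.toTorusSite) =
      ∑ z : TorusSite d L, g (cellCorner z) := fun g => by
    rw [FermionTorus.sum_eq_sum_torusSite]
    simp only [FermionTorus.toTorusSite_ofTorusSite]
  rw [h1, h2] at hsumu hsumd
  linarith

end Finite

/-! ### Thermodynamic limit on the square lattice -/

section Thermodynamic

/-- **Free-fermion (paramagnetic Hartree–Fock) upper bound on the square-lattice Hubbard energy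
density at arbitrary filling.** For `U ≥ 0`, `0 ≤ n < 2` and every continuous occupation profile
`g : (Fin 2 → ℝ) → [0,1]` with `(2π)⁻² ∫_{[-π,π]²} g = n/2`:
`e(t,U,n) ≤ 2 (2π)⁻² ∫_{[-π,π]²} g(p) · 2t(cos p₁ + cos p₂) dp + U (n/2)²`
(the plane wave of momentum `p + (π,π)` has kinetic energy `2t(cos p₁ + cos p₂)` and is filled with
weight `g(p)` in each spin; the interaction of the uniform-density Slater state is `U (n/2)²` per
site). [cite: BachLiebSolovej1994, eq. (2c.36)] -/
theorem energyDensity2D_le_freeFermion (t : ℝ) {U : ℝ} (hU : 0 ≤ U) {n : ℝ} (hn0 : 0 ≤ n)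
    (hn2 : n < 2) {g : (Fin 2 → ℝ) → ℝ} (hgc : Continuous g) (hg0 : ∀ p, 0 ≤ g p)
    (hg1 : ∀ p, g p ≤ 1) (hgn : ((2 * Real.pi) ^ 2)⁻¹ * ∫ p in brillouin 2, g p = n / 2) :
    energyDensity2D t U n ≤
      2 * (((2 * Real.pi) ^ 2)⁻¹ * ∫ p in brillouin 2, g p * sdwBand t p) + U * (n / 2) ^ 2 := by
  -- tori `L = m + 3`
  set φ : ℕ → ℕ := fun m => m + 3 with hφdef
  have hφ : Tendsto φ atTop atTop :=
    tendsto_atTop_atTop.2 fun b => ⟨b, fun m hm => by simp only [hφdef]; omega⟩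
  have hlim : Tendsto (fun m => groundEnergyAt (fermionTorusGraph 2 (φ m)) t U (rectN n (φ m)) /
      ((φ m : ℕ) : ℝ) ^ 2) atTop (𝓝 (energyDensity2D t U n)) :=
    (tendsto_energyDensity2D_torus t hU hn0 hn2).comp hφ
  -- the Riemann sums converge
  have hG : Tendsto (fun m => ((2 * Real.pi) ^ 2)⁻¹ *
      cornerRiemannSum (fun p => g p * sdwBand (d := 2) t p) (φ m)) atTop
      (𝓝 (((2 * Real.pi) ^ 2)⁻¹ * ∫ p in brillouin 2, g p * sdwBand t p)) :=
    ((tendsto_cornerRiemannSum ((hgc.mul (continuous_sdwBand t)).continuousOn)).comp hφ).const_mul _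
  have hg : Tendsto (fun m => ((2 * Real.pi) ^ 2)⁻¹ * cornerRiemannSum g (φ m)) atTop
      (𝓝 (n / 2)) := by
    rw [← hgn]
    exact ((tendsto_cornerRiemannSum hgc.continuousOn).comp hφ).const_mul _
  -- `⌊nL²/2⌋ / L² → n/2`
  have hm : Tendsto (fun m => ((⌊n * ((φ m : ℕ) : ℝ) ^ 2 / 2⌋₊ : ℕ) : ℝ) / ((φ m : ℕ) : ℝ) ^ 2)
      atTop (𝓝 (n / 2)) := by
    have h := ((tendsto_rectN_div_sq hn0).comp hφ).div_const 2
    refine h.congr fun m => ?_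
    simp only [Function.comp_apply, rectN]
    push_cast
    ring
  have hb : Tendsto (fun m =>
      2 * (((2 * Real.pi) ^ 2)⁻¹ * cornerRiemannSum (fun p => g p * sdwBand (d := 2) t p) (φ m)) +
        8 * |t| * |((⌊n * ((φ m : ℕ) : ℝ) ^ 2 / 2⌋₊ : ℕ) : ℝ) / ((φ m : ℕ) : ℝ) ^ 2 -
          ((2 * Real.pi) ^ 2)⁻¹ * cornerRiemannSum g (φ m)| +
        U * (((⌊n * ((φ m : ℕ) : ℝ) ^ 2 / 2⌋₊ : ℕ) : ℝ) / ((φ m : ℕ) : ℝ) ^ 2) ^ 2) atTop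
      (𝓝 (2 * (((2 * Real.pi) ^ 2)⁻¹ * ∫ p in brillouin 2, g p * sdwBand t p) +
        8 * |t| * |n / 2 - n / 2| + U * (n / 2) ^ 2)) :=
    ((hG.const_mul 2).add (((hm.sub hg).abs).const_mul _)).add ((hm.pow 2).const_mul U)
  rw [sub_self, abs_zero, mul_zero, add_zero] at hb
  refine le_of_tendsto_of_tendsto hlim hb (Eventually.of_forall fun m => ?_)
  -- the finite-volume inequality on the torus of side `L = m + 3`, divided by `L²`
  dsimp only
  have hL3 : 3 ≤ φ m := by simp only [hφdef]; omega
  haveI : NeZero (φ m) := ⟨by omega⟩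
  have hLpos : (0 : ℝ) < ((φ m : ℕ) : ℝ) := by exact_mod_cast (show 0 < φ m by omega)
  have hL2 : (0 : ℝ) < ((φ m : ℕ) : ℝ) ^ 2 := by positivity
  rw [show rectN n (φ m) = ⌊n * ((φ m : ℕ) : ℝ) ^ 2 / 2⌋₊ + ⌊n * ((φ m : ℕ) : ℝ) ^ 2 / 2⌋₊ from by
    rw [rectN, two_mul]]
  set mL : ℕ := ⌊n * ((φ m : ℕ) : ℝ) ^ 2 / 2⌋₊ with hmLdef
  have hmL : mL ≤ φ m ^ 2 := by
    have h := rectN_le_two_mul hn0 hn2.le (φ m)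
    rw [rectN, ← hmLdef] at h
    rw [sq]
    omega
  have h := groundEnergyAt_le_of_occupation (d := 2) hL3 t U hg0 hg1 hmL
  rw [← sum_cellCorner_div_eq, ← sum_cellCorner_div_eq]
  have habs : |(mL : ℝ) / ((φ m : ℕ) : ℝ) ^ 2 -
      (∑ z : TorusSite 2 (φ m), g (cellCorner z)) / ((φ m : ℕ) : ℝ) ^ 2| =
      |(mL : ℝ) - ∑ z : TorusSite 2 (φ m), g (cellCorner z)| / ((φ m : ℕ) : ℝ) ^ 2 := by
    rw [← sub_div, abs_div, abs_of_pos hL2]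
  rw [habs, div_le_iff₀ hL2]
  have key : (2 * ((∑ z : TorusSite 2 (φ m), g (cellCorner z) * sdwBand t (cellCorner z)) /
        ((φ m : ℕ) : ℝ) ^ 2) +
      8 * |t| * (|(mL : ℝ) - ∑ z : TorusSite 2 (φ m), g (cellCorner z)| / ((φ m : ℕ) : ℝ) ^ 2) +
      U * ((mL : ℝ) / ((φ m : ℕ) : ℝ) ^ 2) ^ 2) * ((φ m : ℕ) : ℝ) ^ 2 =
      2 * (∑ z : TorusSite 2 (φ m), g (cellCorner z) * sdwBand t (cellCorner z)) +
        8 * |t| * |(mL : ℝ) - ∑ z : TorusSite 2 (φ m), g (cellCorner z)| +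
        U * ((mL : ℝ) * mL) / ((φ m : ℕ) : ℝ) ^ 2 := by
    field_simp
  rw [key]
  have h8 : 2 * (2 * ((2 : ℕ) : ℝ) * |t|) = 8 * |t| := by push_cast; ring
  rw [h8] at h
  exact h

/-- `⌊ν L²⌋ / L² → ν` for `ν ≥ 0`. [folklore] -/
theorem tendsto_natFloor_mul_sq_div_sq {ν : ℝ} (hν : 0 ≤ ν) :
    Tendsto (fun L : ℕ => ((⌊ν * (L : ℝ) ^ 2⌋₊ : ℕ) : ℝ) / (L : ℝ) ^ 2) atTop (𝓝 ν) := by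
  have h := (tendsto_rectN_div_sq (n := 2 * ν) (by positivity)).div_const 2
  rw [mul_div_cancel_left₀ ν two_ne_zero] at h
  refine h.congr fun L => ?_
  rw [rectN, show 2 * ν * (L : ℝ) ^ 2 / 2 = ν * (L : ℝ) ^ 2 by ring]
  push_cast
  ring

/-- **Free-fermion upper bound with INDEPENDENT spin occupations (collinear Slater states: the
polarised Fermi sea, paramagnetic seas of unequal densities) in the thermodynamic limit.** For
`U ≥ 0`, densities `0 ≤ n↑, n↓ ≤ 1` with `n↑ + n↓ < 2` and continuous occupation profiles
`g↑, g↓ : (Fin 2 → ℝ) → [0,1]` with `(2π)⁻² ∫_{[-π,π]²} g_σ = n_σ`: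
`e(t,U,n↑ + n↓) ≤ (2π)⁻² ∫ g↑ ε + (2π)⁻² ∫ g↓ ε + U n↑ n↓`, `ε(p) = 2t(cos p₁ + cos p₂)`
(each spin filled with weight `g_σ(p)` at momentum `p + (π,π)`; interaction `U n↑n↓` per site).
`g↓ = 0` is the fully spin-polarised Fermi sea (no interaction energy, any `U ≥ 0`); `g↑ = g↓`
recovers `energyDensity2D_le_freeFermion`. [cite: BachLiebSolovej1994, eq. (2c.36)] -/
theorem energyDensity2D_le_freeFermion₂ (t : ℝ) {U : ℝ} (hU : 0 ≤ U) {nu nd : ℝ}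
    (hnu0 : 0 ≤ nu) (hnu1 : nu ≤ 1) (hnd0 : 0 ≤ nd) (hnd1 : nd ≤ 1) (hn2 : nu + nd < 2)
    {gu gd : (Fin 2 → ℝ) → ℝ} (hguc : Continuous gu) (hgu0 : ∀ p, 0 ≤ gu p)
    (hgu1 : ∀ p, gu p ≤ 1) (hgdc : Continuous gd) (hgd0 : ∀ p, 0 ≤ gd p) (hgd1 : ∀ p, gd p ≤ 1)
    (hgun : ((2 * Real.pi) ^ 2)⁻¹ * ∫ p in brillouin 2, gu p = nu)
    (hgdn : ((2 * Real.pi) ^ 2)⁻¹ * ∫ p in brillouin 2, gd p = nd) :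
    energyDensity2D t U (nu + nd) ≤
      ((2 * Real.pi) ^ 2)⁻¹ * (∫ p in brillouin 2, gu p * sdwBand t p) +
        ((2 * Real.pi) ^ 2)⁻¹ * (∫ p in brillouin 2, gd p * sdwBand t p) + U * (nu * nd) := by
  set n : ℝ := nu + nd with hndef
  have hn0 : 0 ≤ n := add_nonneg hnu0 hnd0
  -- tori `L = m + 3`
  set φ : ℕ → ℕ := fun m => m + 3 with hφdef
  have hφ : Tendsto φ atTop atTop :=
    tendsto_atTop_atTop.2 fun b => ⟨b, fun m hm => by simp only [hφdef]; omega⟩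
  have hlim : Tendsto (fun m => groundEnergyAt (fermionTorusGraph 2 (φ m)) t U (rectN n (φ m)) /
      ((φ m : ℕ) : ℝ) ^ 2) atTop (𝓝 (energyDensity2D t U n)) :=
    (tendsto_energyDensity2D_torus t hU hn0 hn2).comp hφ
  -- particle numbers per spin: `M↑ = min(⌊n↑L²⌋, N_L(n))`, `M↓ = N_L(n) - M↑`
  set Mu : ℕ → ℕ := fun L => min ⌊nu * (L : ℝ) ^ 2⌋₊ (rectN n L) with hMudef
  set Md : ℕ → ℕ := fun L => rectN n L - Mu L with hMddef
  have hMu_le : ∀ L, Mu L ≤ rectN n L := fun L => min_le_right _ _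
  have hsumN : ∀ L, Mu L + Md L = rectN n L := fun L => Nat.add_sub_cancel' (hMu_le L)
  have hfloor_le : ∀ L : ℕ, (⌊nu * (L : ℝ) ^ 2⌋₊ : ℕ) ≤ L ^ 2 := fun L => by
    have h1 : ((⌊nu * (L : ℝ) ^ 2⌋₊ : ℕ) : ℝ) ≤ nu * (L : ℝ) ^ 2 := Nat.floor_le (by positivity)
    have h2 : nu * (L : ℝ) ^ 2 ≤ (L : ℝ) ^ 2 := by nlinarith [sq_nonneg (L : ℝ)]
    exact_mod_cast h1.trans h2
  have hMuL : ∀ L : ℕ, Mu L ≤ L ^ 2 := fun L => (min_le_left _ _).trans (hfloor_le L)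
  have hMdL : ∀ L : ℕ, Md L ≤ L ^ 2 := fun L => by
    by_cases hc : ⌊nu * (L : ℝ) ^ 2⌋₊ ≤ rectN n L
    · have hMu : Mu L = ⌊nu * (L : ℝ) ^ 2⌋₊ := min_eq_left hc
      have hR : (rectN n L : ℝ) ≤ n * (L : ℝ) ^ 2 := rectN_le hn0 L
      have hfl : nu * (L : ℝ) ^ 2 < ((⌊nu * (L : ℝ) ^ 2⌋₊ : ℕ) : ℝ) + 1 := Nat.lt_floor_add_one _
      have hnd' : nd * (L : ℝ) ^ 2 ≤ (L : ℝ) ^ 2 := by nlinarith [sq_nonneg (L : ℝ)]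
      have hlt : ((Md L : ℕ) : ℝ) < ((L ^ 2 + 1 : ℕ) : ℝ) := by
        simp only [hMddef]
        rw [Nat.cast_sub (hMu_le L), hMu]
        push_cast
        have : n * (L : ℝ) ^ 2 = nu * (L : ℝ) ^ 2 + nd * (L : ℝ) ^ 2 := by rw [hndef]; ring
        linarith
      have hlt' : Md L < L ^ 2 + 1 := by exact_mod_cast hlt
      omega
    · have hMu : Mu L = rectN n L := min_eq_right (not_le.mp hc).le
      simp only [hMddef, hMu, Nat.sub_self]
      exact Nat.zero_le _
  -- `M↑/L² → n↑`, `M↓/L² → n↓`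
  have hR : Tendsto (fun m => (rectN n (φ m) : ℝ) / ((φ m : ℕ) : ℝ) ^ 2) atTop (𝓝 n) :=
    (tendsto_rectN_div_sq hn0).comp hφ
  have hF : Tendsto (fun m => ((⌊nu * ((φ m : ℕ) : ℝ) ^ 2⌋₊ : ℕ) : ℝ) / ((φ m : ℕ) : ℝ) ^ 2)
      atTop (𝓝 nu) :=
    (tendsto_natFloor_mul_sq_div_sq hnu0).comp hφ
  have hMu_t : Tendsto (fun m => ((Mu (φ m) : ℕ) : ℝ) / ((φ m : ℕ) : ℝ) ^ 2) atTop (𝓝 nu) := by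
    have h := hF.min hR
    rw [min_eq_left (show nu ≤ n by simp only [hndef]; linarith)] at h
    refine h.congr fun m => ?_
    simp only [hMudef, Nat.cast_min]
    exact min_div_div_right (by positivity) _ _
  have hMd_t : Tendsto (fun m => ((Md (φ m) : ℕ) : ℝ) / ((φ m : ℕ) : ℝ) ^ 2) atTop (𝓝 nd) := by
    have h := hR.sub hMu_t
    rw [show n - nu = nd by simp only [hndef]; ring] at h
    refine h.congr fun m => ?_
    simp only [hMddef]
    rw [Nat.cast_sub (hMu_le _), sub_div]
  -- the Riemann sums converge
  have hGu : Tendsto (fun m => ((2 * Real.pi) ^ 2)⁻¹ *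
      cornerRiemannSum (fun p => gu p * sdwBand (d := 2) t p) (φ m)) atTop
      (𝓝 (((2 * Real.pi) ^ 2)⁻¹ * ∫ p in brillouin 2, gu p * sdwBand t p)) :=
    ((tendsto_cornerRiemannSum ((hguc.mul (continuous_sdwBand t)).continuousOn)).comp hφ).const_mul _
  have hGd : Tendsto (fun m => ((2 * Real.pi) ^ 2)⁻¹ *
      cornerRiemannSum (fun p => gd p * sdwBand (d := 2) t p) (φ m)) atTop
      (𝓝 (((2 * Real.pi) ^ 2)⁻¹ * ∫ p in brillouin 2, gd p * sdwBand t p)) :=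
    ((tendsto_cornerRiemannSum ((hgdc.mul (continuous_sdwBand t)).continuousOn)).comp hφ).const_mul _
  have hgu : Tendsto (fun m => ((2 * Real.pi) ^ 2)⁻¹ * cornerRiemannSum gu (φ m)) atTop
      (𝓝 nu) := by
    rw [← hgun]
    exact ((tendsto_cornerRiemannSum hguc.continuousOn).comp hφ).const_mul _
  have hgd : Tendsto (fun m => ((2 * Real.pi) ^ 2)⁻¹ * cornerRiemannSum gd (φ m)) atTop
      (𝓝 nd) := by
    rw [← hgdn]
    exact ((tendsto_cornerRiemannSum hgdc.continuousOn).comp hφ).const_mul _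
  have hb : Tendsto (fun m =>
      ((2 * Real.pi) ^ 2)⁻¹ * cornerRiemannSum (fun p => gu p * sdwBand (d := 2) t p) (φ m) +
        4 * |t| * |((Mu (φ m) : ℕ) : ℝ) / ((φ m : ℕ) : ℝ) ^ 2 -
          ((2 * Real.pi) ^ 2)⁻¹ * cornerRiemannSum gu (φ m)| +
      (((2 * Real.pi) ^ 2)⁻¹ * cornerRiemannSum (fun p => gd p * sdwBand (d := 2) t p) (φ m) +
        4 * |t| * |((Md (φ m) : ℕ) : ℝ) / ((φ m : ℕ) : ℝ) ^ 2 -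
          ((2 * Real.pi) ^ 2)⁻¹ * cornerRiemannSum gd (φ m)|) +
        U * (((Mu (φ m) : ℕ) : ℝ) / ((φ m : ℕ) : ℝ) ^ 2 *
          (((Md (φ m) : ℕ) : ℝ) / ((φ m : ℕ) : ℝ) ^ 2))) atTop
      (𝓝 (((2 * Real.pi) ^ 2)⁻¹ * (∫ p in brillouin 2, gu p * sdwBand t p) +
        4 * |t| * |nu - nu| +
        (((2 * Real.pi) ^ 2)⁻¹ * (∫ p in brillouin 2, gd p * sdwBand t p) + 4 * |t| * |nd - nd|) +
        U * (nu * nd))) :=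
    ((hGu.add (((hMu_t.sub hgu).abs).const_mul _)).add
      (hGd.add (((hMd_t.sub hgd).abs).const_mul _))).add ((hMu_t.mul hMd_t).const_mul U)
  rw [sub_self, sub_self, abs_zero, mul_zero, add_zero, add_zero] at hb
  refine le_of_tendsto_of_tendsto hlim hb (Eventually.of_forall fun m => ?_)
  -- the finite-volume inequality on the torus of side `L = m + 3`, divided by `L²`
  dsimp only
  have hL3 : 3 ≤ φ m := by simp only [hφdef]; omega
  haveI : NeZero (φ m) := ⟨by omega⟩
  have hL2 : (0 : ℝ) < ((φ m : ℕ) : ℝ) ^ 2 := by positivity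
  rw [← hsumN (φ m)]
  have h := groundEnergyAt_le_of_occupation₂ (d := 2) hL3 t U hgu0 hgu1 hgd0 hgd1
    (hMuL (φ m)) (hMdL (φ m))
  rw [← sum_cellCorner_div_eq, ← sum_cellCorner_div_eq, ← sum_cellCorner_div_eq,
    ← sum_cellCorner_div_eq]
  have habs : ∀ (M : ℕ) (g : (Fin 2 → ℝ) → ℝ), |(M : ℝ) / ((φ m : ℕ) : ℝ) ^ 2 -
      (∑ z : TorusSite 2 (φ m), g (cellCorner z)) / ((φ m : ℕ) : ℝ) ^ 2| =
      |(M : ℝ) - ∑ z : TorusSite 2 (φ m), g (cellCorner z)| / ((φ m : ℕ) : ℝ) ^ 2 := by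
    intro M g
    rw [← sub_div, abs_div, abs_of_pos hL2]
  rw [habs, habs, div_le_iff₀ hL2]
  have key : ((∑ z : TorusSite 2 (φ m), gu (cellCorner z) * sdwBand t (cellCorner z)) /
        ((φ m : ℕ) : ℝ) ^ 2 +
      4 * |t| * (|((Mu (φ m) : ℕ) : ℝ) - ∑ z : TorusSite 2 (φ m), gu (cellCorner z)| /
        ((φ m : ℕ) : ℝ) ^ 2) +
      ((∑ z : TorusSite 2 (φ m), gd (cellCorner z) * sdwBand t (cellCorner z)) /
        ((φ m : ℕ) : ℝ) ^ 2 +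
      4 * |t| * (|((Md (φ m) : ℕ) : ℝ) - ∑ z : TorusSite 2 (φ m), gd (cellCorner z)| /
        ((φ m : ℕ) : ℝ) ^ 2)) +
      U * (((Mu (φ m) : ℕ) : ℝ) / ((φ m : ℕ) : ℝ) ^ 2 *
        (((Md (φ m) : ℕ) : ℝ) / ((φ m : ℕ) : ℝ) ^ 2))) * ((φ m : ℕ) : ℝ) ^ 2 =
      (∑ z : TorusSite 2 (φ m), gu (cellCorner z) * sdwBand t (cellCorner z)) +
        4 * |t| * |((Mu (φ m) : ℕ) : ℝ) - ∑ z : TorusSite 2 (φ m), gu (cellCorner z)| +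
      ((∑ z : TorusSite 2 (φ m), gd (cellCorner z) * sdwBand t (cellCorner z)) +
        4 * |t| * |((Md (φ m) : ℕ) : ℝ) - ∑ z : TorusSite 2 (φ m), gd (cellCorner z)|) +
      U * (((Mu (φ m) : ℕ) : ℝ) * (Md (φ m) : ℕ)) / ((φ m : ℕ) : ℝ) ^ 2 := by
    field_simp
  rw [key]
  have h4 : 2 * ((2 : ℕ) : ℝ) * |t| = 4 * |t| := by push_cast; ring
  rw [h4] at h
  exact h

/-- **The fully spin-polarised Fermi sea**: for `U ≥ 0`, `0 ≤ n ≤ 1` and every continuous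
`g : (Fin 2 → ℝ) → [0,1]` with `(2π)⁻² ∫ g = n`, `e(t,U,n) ≤ (2π)⁻² ∫ g(p) · 2t(cos p₁ + cos p₂) dp`
(one spin species filled with weight `g`, the other empty: no interaction energy; a bound uniform
in `U`). [cite: BachLiebSolovej1994, eq. (2c.36)] -/
theorem energyDensity2D_le_polarizedFreeFermion (t : ℝ) {U : ℝ} (hU : 0 ≤ U) {n : ℝ}
    (hn0 : 0 ≤ n) (hn1 : n ≤ 1) {g : (Fin 2 → ℝ) → ℝ} (hgc : Continuous g) (hg0 : ∀ p, 0 ≤ g p)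
    (hg1 : ∀ p, g p ≤ 1) (hgn : ((2 * Real.pi) ^ 2)⁻¹ * ∫ p in brillouin 2, g p = n) :
    energyDensity2D t U n ≤ ((2 * Real.pi) ^ 2)⁻¹ * ∫ p in brillouin 2, g p * sdwBand t p := by
  have h := energyDensity2D_le_freeFermion₂ t hU hn0 hn1 le_rfl zero_le_one
    (by linarith : n + 0 < 2) hgc hg0 hg1 (gd := fun _ => 0) continuous_const (fun _ => le_rfl)
    (fun _ => zero_le_one) hgn (by simp)
  simpa using h

end Thermodynamic

end HartreeFock

end Literature.MathematicalPhysics.QuantumLattice
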